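import Literature.MathematicalPhysics.QuantumFieldTheory.O2NeutralSectorsBoundCells
import HarnessLib

/-!
# O(2) scan, charge-`4` sector: the finite-certificate rules (cells, boxes, apex, heavy range)

The charge-`4` condition of the O(2) three-scalar scan is SCALAR: `α(V⃗_{4,Δ,ℓ}[g]) ≥ 0` with the single
label `tttt` (equal external dimensions), rows `2F⁻_{Δ_t}`, `2F⁺_{Δ_t}` (`O2ThreeScalarCrossing.V4`).
`O2NeutralSectorsTermwise` already supplies its termwise skeleton (`sector4Value`, `sector4Term`,
`pos4_of_termwise`, `pos4_of_eventually_right`): the `z`-series has the NON-NEGATIVE single-correlator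
coefficients `A_{n,j}(Δ, ℓ)/λ_ℓ`. This file supplies the reader's rules, all `1 × 1` specialisations of
the neutral-sector rules of `O2NeutralSectorsCells/Tail/BoundCells`:

* §1 the sector-`4` term is a two-weight evaluation: `sector4Term F D E j = T(c₄, d₄; Δ_t)[𝒫_{E,j}]` with
  `c₄ = 2(w⁴ + w⁵)`, `d₄ = 2(w⁴ − w⁵)` (tree indices `4, 5`) (`sector4Term_eq_twoWeightEval`);
* §2 rule (M): `0 ≤ cornerBound₂ c₄ d₄ j E₁ E₂ Δ_t Δ_t ⇒ 0 ≤ sector4Term F D E j` on `E ∈ [E₁, E₂]`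
  (`sector4Term_nonneg_on_box`);
* §3 rule (T): in the dominated node configuration with apex `a`, the single number
  `c₄(a) v_a^{Δ_t} − apexRadTW(c₄, d₄; Δ_t, E_T) ≥ 0` gives `0 ≤ sector4Term F D E j` for all `E ≥ E_T`,
  `j ≤ E` (`sector4Term_nonneg_of_apex`);
* §4 the HEAVY range: `pos4_heavy` — the item `tail_4` of `O2Obligations` (all spins, all points);
* §5 LIGHT cells strictly above the bound with the interval tables (`pos4_on_cell_Ico`,
  `pos4_on_cell_Ico_of_corners`), bound cells from `a = ℓ + 1` with the monotone tables
  (`pos4_on_boundCell_Ico_of_corners`), and the cell tails from (M)/(T) (`cellTail4_of_termwise`).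

R-07.5 PLANNING for the O(2) client path (Lean statements a JSON-kind reader discharges); no numerics.

References: Chester–Landry–Liu–Poland–Simmons-Duffin–Su–Vichi, JHEP 06 (2020) 142, §3.1, App. «Crossing
vectors» (`ChesterEtAl2020`); Hogervorst–Rychkov, Phys. Rev. D 87 (2013) 106004, §3 eqs. (3.6), (3.9)
(`HogervorstRychkov2013`); Kos–Poland–Simmons-Duffin, JHEP 11 (2014) 109, §3.3 eq. (3.16), §4 eqs.
(4.2)–(4.3) (`KosPolandSimmonsduffin2014`); Dolan–Osborn, Nucl. Phys. B 678 (2004) 491, §3 eq. (3.11)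
(`DolanOsborn2004`).
-/

namespace Literature.MathematicalPhysics.QuantumFieldTheory.O2ChargeFourRules

open Finset Set Matrix Filter Topology
open Literature.MathematicalPhysics.QuantumFieldTheory.O2ThreeScalarCrossing
open Literature.MathematicalPhysics.QuantumFieldTheory.O2ThreeScalarSystem
open Literature.MathematicalPhysics.QuantumFieldTheory.O2OPEScanBridge
open Literature.MathematicalPhysics.QuantumFieldTheory.O2ScanObligations
open Literature.MathematicalPhysics.QuantumFieldTheory.O2NeutralSectorsTermwise
open Literature.MathematicalPhysics.QuantumFieldTheory.O2NeutralSectorsTail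
open Literature.MathematicalPhysics.QuantumFieldTheory.O2NeutralSectorsBoundCells
open ConformalBootstrap3D (IsConformalBlock3D IsRegularPoint3D unitarityBound3D accidentalDegeneracy3D
  hrCoeff legendreLam InDescendantRange legendreLam_pos hrCoeffLo hrCoeffHi hrCoeff_mem_Icc_interval
  hrCoeffMLo hrCoeffMHi hrCoeff_monotone_sandwich headCellSumI headCellSumM min_mul_le_mul_of_bounds
  eventually_isRegularPoint3D_nhdsGT_of_bound_le unitarityBound3D_le_add_one zMono zMono_nonneg
  twoWeightEval cornerBound₂ cornerBound₂_le crossF natCast_add_le_of_unitarityBound3D_lt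
  natCast_add_half_le_unitarityBound3D)

/-! ### §1 The sector-`4` term as a two-weight evaluation -/

/-- Direct weight of the charge-`4` value: `c₄ = 2(w⁴ + w⁵)`. [cite: ChesterEtAl2020, App. «Crossing vectors» (`V⃗_{4,Δ,ℓ⁺}`)] -/
noncomputable def cWeight4 (F : ScanFunctional) (m : Fin F.M) : ℝ := 2 * (F.w m 4 + F.w m 5)

/-- Reflected weight of the charge-`4` value: `d₄ = 2(w⁴ − w⁵)`. [cite: ChesterEtAl2020, App. «Crossing vectors» (`V⃗_{4,Δ,ℓ⁺}`)] -/
noncomputable def dWeight4 (F : ScanFunctional) (m : Fin F.M) : ℝ := 2 * (F.w m 4 - F.w m 5)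

/-- **The charge-`4` value is a two-weight evaluation**: `α(V⃗_4[G]) = T(c₄, d₄; Δ_t)[G_{tttt}]`.
[cite: ChesterEtAl2020, App. «Crossing vectors» (`V⃗_{4,Δ,ℓ⁺}`)] [cite: HogervorstRychkov2013, §3 eq. (3.6)] -/
theorem sector4Value_eq_twoWeightEval (F : ScanFunctional) (D : Dims) (G : Label → ℝ → ℝ → ℝ) :
    sector4Value F D G = twoWeightEval (cWeight4 F) (dWeight4 F) F.z F.zb (D.expo .tttt) (G .tttt) := by
  simp only [sector4Value, nodeEval_apply, crossF, twoWeightEval, Finset.mul_sum, ← Finset.sum_add_distrib]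
  exact Finset.sum_congr rfl fun m _ => by simp only [cWeight4, dWeight4]; ring

/-- **The sector-`4` term is a two-weight evaluation of `𝒫_{E,j}`.** [cite: HogervorstRychkov2013, §3 eqs. (3.6), (3.9)] -/
theorem sector4Term_eq_twoWeightEval (F : ScanFunctional) (D : Dims) (E : ℝ) (j : ℕ) :
    sector4Term F D E j = twoWeightEval (cWeight4 F) (dWeight4 F) F.z F.zb (D.expo .tttt) (zMono E j) := by
  rw [sector4Term, sector4Value_eq_twoWeightEval]

/-! ### §2 Rule (M): boxes -/

/-- **Rule (M), charge `4`**: on a box `E ∈ [E₁, E₂]` at fixed `j`, the corner number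
`cornerBound₂ c₄ d₄ j E₁ E₂ Δ_t Δ_t ≥ 0` gives `sector4Term F D E j ≥ 0`. [cite: HogervorstRychkov2013, §3 eq. (3.6)] -/
theorem sector4Term_nonneg_on_box (F : ScanFunctional) (D : Dims) (j : ℕ) {E₁ E₂ : ℝ}
    (h : 0 ≤ cornerBound₂ (cWeight4 F) (dWeight4 F) F.z F.zb j E₁ E₂ (D.expo .tttt) (D.expo .tttt)) :
    ∀ E ∈ Icc E₁ E₂, 0 ≤ sector4Term F D E j := by
  intro E hE
  rw [sector4Term_eq_twoWeightEval]
  exact h.trans (cornerBound₂_le (cWeight4 F) (dWeight4 F) F.z F.zb F.hz F.hzb j hE ⟨le_rfl, le_rfl⟩)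

/-! ### §3 Rule (T): the apex -/

/-- **Rule (T), charge `4`**: in the dominated node configuration with apex `a`, the number
`c₄(a) v_a^{Δ_t} − apexRadTW(c₄, d₄; Δ_t, E_T) ≥ 0` gives `sector4Term F D E j ≥ 0` for every `E ≥ E_T`,
`j ≤ E`. [cite: HogervorstRychkov2013, §3 eq. (3.6)] -/
theorem sector4Term_nonneg_of_apex (F : ScanFunctional) (D : Dims) (hord : ∀ m, F.zb m ≤ F.z m)
    (a : Fin F.M) (qd qr : Fin F.M → ℝ) (hqd : ∀ m, 0 < qd m ∧ qd m ≤ 1)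
    (hqr : ∀ m, 0 < qr m ∧ qr m ≤ 1)
    (hdomd : ∀ m, F.z m * F.zb m ≤ qd m ^ 2 * (F.z a * F.zb a) ∧ F.z m ≤ qd m * F.z a)
    (hdomr : ∀ m, (1 - F.z m) * (1 - F.zb m) ≤ qr m ^ 2 * (F.z a * F.zb a) ∧ 1 - F.zb m ≤ qr m * F.z a)
    {ET : ℝ} (hapex : 0 ≤ cWeight4 F a * ((1 - F.z a) * (1 - F.zb a)) ^ D.expo .tttt -
      apexRadTW F (cWeight4 F) (dWeight4 F) a qd qr (D.expo .tttt) ET) :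
    ∀ E : ℝ, ET ≤ E → ∀ j : ℕ, (j : ℝ) ≤ E → 0 ≤ sector4Term F D E j := by
  intro E hE j hjE
  have hP : 0 ≤ zMono E j (F.z a) (F.zb a) := zMono_nonneg E j (F.hz a).1.le (F.hzb a).1.le
  have h := abs_twoWeightEval_sub_apex_le F hord a qd qr (fun m => (hqd m).1) (fun m => (hqr m).1)
    hdomd hdomr hjE (cWeight4 F) (dWeight4 F) (D.expo .tttt)
  rw [abs_le] at h
  have hanti := apexRadTW_anti_level F (cWeight4 F) (dWeight4 F) a hqd hqr (D.expo .tttt) hE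
  rw [sector4Term_eq_twoWeightEval]
  nlinarith [h.1, mul_le_mul_of_nonneg_left hanti hP, mul_nonneg hP hapex]

/-! ### §4 The heavy range `Δ ≥ E₀` -/

/-- **Heavy range, charge `4`, regular point** (twist-gap domain `j + τ ≤ E`, `τ ≤ 1`, `τ ≤ E₀`).
[cite: HogervorstRychkov2013, §3 eqs. (3.6), (3.9)] [cite: KosPolandSimmonsduffin2014, §3.3 eq. (3.16)] -/
theorem sector4Value_nonneg_heavy (F : ScanFunctional) (D : Dims) {E₀ ET τ : ℝ} (hτ1 : τ ≤ 1)
    (hτ0 : τ ≤ E₀)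
    (hM : ∀ (j : ℕ) (E : ℝ), E₀ ≤ E → E < ET → (j : ℝ) + τ ≤ E → 0 ≤ sector4Term F D E j)
    (hT : ∀ E : ℝ, ET ≤ E → ∀ j : ℕ, (j : ℝ) ≤ E → 0 ≤ sector4Term F D E j)
    {Δ : ℝ} {ℓ : ℕ} (hΔ : unitarityBound3D ℓ < Δ) (hreg : ¬ accidentalDegeneracy3D Δ ℓ) (hΔ0 : E₀ ≤ Δ)
    {G : Label → ℝ → ℝ → ℝ} (hG : ∀ L ∈ labels4, IsConformalBlock3D 0 0 Δ ℓ (G L)) :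
    0 ≤ sector4Value F D G := by
  refine sector4Value_nonneg_of_termwise F D hΔ hreg ∅ (by simp) (fun q _ hq => ?_) hG
  have hℓτ : (ℓ : ℝ) + τ ≤ Δ := natCast_add_le_of_unitarityBound3D_lt hτ1 hτ0 hΔ hΔ0
  have h1 : (q.2 : ℝ) ≤ (ℓ : ℝ) + (q.1 : ℝ) := by exact_mod_cast hq.2.1
  have hjE : (q.2 : ℝ) + τ ≤ Δ + (q.1 : ℝ) := by linarith
  have hjE' : (q.2 : ℝ) ≤ Δ + (q.1 : ℝ) := by linarith [natCast_add_half_le_unitarityBound3D ℓ]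
  have hE0 : E₀ ≤ Δ + (q.1 : ℝ) := hΔ0.trans (le_add_of_nonneg_right (Nat.cast_nonneg _))
  by_cases hlt : Δ + (q.1 : ℝ) < ET
  · exact hM q.2 (Δ + (q.1 : ℝ)) hE0 hlt hjE
  · exact hT (Δ + (q.1 : ℝ)) (not_lt.1 hlt) q.2 hjE'

/-- **Heavy range, charge `4`, all points** (the item `tail_4` of `O2Obligations`, here for every spin).
[cite: KosPolandSimmonsduffin2014, §3.3 eq. (3.16), §4 eqs. (4.2)–(4.3)] [cite: ChesterEtAl2020, §3.1] -/
theorem pos4_heavy (F : ScanFunctional) (D : Dims) {E₀ ET τ : ℝ} (hτ1 : τ ≤ 1) (hτ0 : τ ≤ E₀)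
    (hM : ∀ (j : ℕ) (E : ℝ), E₀ ≤ E → E < ET → (j : ℝ) + τ ≤ E → 0 ≤ sector4Term F D E j)
    (hT : ∀ E : ℝ, ET ≤ E → ∀ j : ℕ, (j : ℝ) ≤ E → 0 ≤ sector4Term F D E j) :
    ∀ ℓ : ℕ, ∀ Δ : ℝ, unitarityBound3D ℓ ≤ Δ → E₀ ≤ Δ → Pos4 F.toFunctional D Δ ℓ := by
  intro ℓ Δ hbd hΔ0
  by_cases hr : IsRegularPoint3D Δ ℓ
  · exact pos4_of_forall_sector4Value_nonneg F D fun G hG =>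
      sector4Value_nonneg_heavy F D hτ1 hτ0 hM hT (lt_of_le_of_ne hbd (Ne.symm hr.1)) hr.2 hΔ0 hG
  · refine pos4_of_eventually_right F D hr ?_
    filter_upwards [eventually_isRegularPoint3D_nhdsGT_of_bound_le hbd, self_mem_nhdsWithin]
      with Δ' hΔ' hgt
    have hgt' : Δ < Δ' := Set.mem_Ioi.1 hgt
    exact ⟨hΔ', fun G hG => sector4Value_nonneg_heavy F D hτ1 hτ0 hM hT (lt_of_le_of_lt hbd hgt') hΔ'.2
      (hΔ0.trans hgt'.le) hG⟩

/-! ### §5 Light cells -/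

/-- **Charge-`4` CELL RULE** (cell `[a, b]` strictly above the unitarity bound, interval tables): a table
`Φlo_q ≤ sector4Term(Δ + n, j)` on the cell, the head number `headCellSumI ℓ a b S Φlo ≥ 0`, and
nonnegative tail terms on `E ∈ [a+n, b+n]` give `Pos4` at every `Δ ∈ [a, b)`.
[cite: KosPolandSimmonsduffin2014, §3.3 eq. (3.16), §4 eqs. (4.2)–(4.3)] [cite: HogervorstRychkov2013, §3 eqs. (3.6), (3.9)] -/
theorem pos4_on_cell_Ico (F : ScanFunctional) (D : Dims) {ℓ : ℕ} {a b : ℝ}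
    (ha : unitarityBound3D ℓ < a) (S : Finset (ℕ × ℕ)) (Φlo : ℕ × ℕ → ℝ)
    (hΦ : ∀ q ∈ S, ∀ Δ ∈ Icc a b, Φlo q ≤ sector4Term F D (Δ + (q.1 : ℝ)) q.2)
    (hX : 0 ≤ headCellSumI ℓ a b S Φlo)
    (htail : ∀ q : ℕ × ℕ, q ∉ S → InDescendantRange ℓ q.1 q.2 →
      ∀ E ∈ Icc (a + q.1) (b + q.1), 0 ≤ sector4Term F D E q.2) :
    ∀ Δ ∈ Ico a b, Pos4 F.toFunctional D Δ ℓ := by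
  have hcell : ∀ Δ ∈ Icc a b, IsRegularPoint3D Δ ℓ → Pos4 F.toFunctional D Δ ℓ := by
    intro Δ hΔ hreg
    have hlt : unitarityBound3D ℓ < Δ := lt_of_lt_of_le ha hΔ.1
    have hlam : 0 < legendreLam ℓ := legendreLam_pos ℓ
    refine pos4_of_termwise F D hlt hreg.2 S ?_
      (fun q hq hr => htail q hq hr (Δ + (q.1 : ℝ)) ⟨by linarith [hΔ.1], by linarith [hΔ.2]⟩)
    have hsum : headCellSumI ℓ a b S Φlo ≤
        ∑ q ∈ S, hrCoeff Δ ℓ q.1 q.2 * sector4Term F D (Δ + (q.1 : ℝ)) q.2 := by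
      refine Finset.sum_le_sum fun q hq => ?_
      have hA := hrCoeff_mem_Icc_interval ha hΔ.1 hΔ.2 q.1 q.2
      exact min_mul_le_mul_of_bounds hA.2.1 hA.2.2 (hA.1.trans hA.2.1) (hΦ q hq Δ hΔ)
    have heq : ∑ q ∈ S, hrCoeff Δ ℓ q.1 q.2 / legendreLam ℓ * sector4Term F D (Δ + (q.1 : ℝ)) q.2 =
        (legendreLam ℓ)⁻¹ * ∑ q ∈ S, hrCoeff Δ ℓ q.1 q.2 * sector4Term F D (Δ + (q.1 : ℝ)) q.2 := by
      rw [Finset.mul_sum]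
      exact Finset.sum_congr rfl fun q _ => by rw [div_eq_inv_mul]; ring
    rw [heq]
    exact mul_nonneg (inv_nonneg.mpr hlam.le) (hX.trans hsum)
  intro Δ hΔ
  by_cases hr : IsRegularPoint3D Δ ℓ
  · exact hcell Δ ⟨hΔ.1, hΔ.2.le⟩ hr
  · have hbd : unitarityBound3D ℓ ≤ Δ := ha.le.trans hΔ.1
    refine pos4_of_eventually_right F D hr ?_
    filter_upwards [eventually_isRegularPoint3D_nhdsGT_of_bound_le hbd, Ioo_mem_nhdsGT hΔ.2]
      with Δ' hΔ'reg hΔ'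
    refine ⟨hΔ'reg, fun G hG => ?_⟩
    have h := hcell Δ' ⟨hΔ.1.trans hΔ'.1.le, hΔ'.2.le⟩ hΔ'reg
    have hlt : unitarityBound3D ℓ < Δ' := lt_of_le_of_lt hbd hΔ'.1
    -- at a regular point `Pos4` and the z-level value inequality coincide via the termwise sum
    exact sector4Value_nonneg_of_termwise F D hlt hΔ'reg.2 S (by
      have hΔI : Δ' ∈ Icc a b := ⟨hΔ.1.trans hΔ'.1.le, hΔ'.2.le⟩
      have hsum : headCellSumI ℓ a b S Φlo ≤
          ∑ q ∈ S, hrCoeff Δ' ℓ q.1 q.2 * sector4Term F D (Δ' + (q.1 : ℝ)) q.2 := by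
        refine Finset.sum_le_sum fun q hq => ?_
        have hA := hrCoeff_mem_Icc_interval ha hΔI.1 hΔI.2 q.1 q.2
        exact min_mul_le_mul_of_bounds hA.2.1 hA.2.2 (hA.1.trans hA.2.1) (hΦ q hq Δ' hΔI)
      have heq : ∑ q ∈ S, hrCoeff Δ' ℓ q.1 q.2 / legendreLam ℓ * sector4Term F D (Δ' + (q.1 : ℝ)) q.2 =
          (legendreLam ℓ)⁻¹ * ∑ q ∈ S, hrCoeff Δ' ℓ q.1 q.2 * sector4Term F D (Δ' + (q.1 : ℝ)) q.2 := by
        rw [Finset.mul_sum]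
        exact Finset.sum_congr rfl fun q _ => by rw [div_eq_inv_mul]; ring
      rw [heq]
      exact mul_nonneg (inv_nonneg.mpr (legendreLam_pos ℓ).le) (hX.trans hsum))
      (fun q hq hr' => htail q hq hr' (Δ' + (q.1 : ℝ))
        ⟨by linarith [hΔ.1, hΔ'.1], by linarith [hΔ'.2]⟩) hG

/-- **Charge-`4` cell rule with corner tables**: `Φlo_q = cornerBound₂ c₄ d₄ j (a+n) (b+n) Δ_t Δ_t`.
[cite: KosPolandSimmonsduffin2014, §3.3 eq. (3.16), §4 eqs. (4.2)–(4.3)] [cite: HogervorstRychkov2013, §3 eqs. (3.6), (3.9)] -/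
theorem pos4_on_cell_Ico_of_corners (F : ScanFunctional) (D : Dims) {ℓ : ℕ} {a b : ℝ}
    (ha : unitarityBound3D ℓ < a) (S : Finset (ℕ × ℕ))
    (hX : 0 ≤ headCellSumI ℓ a b S (fun q => cornerBound₂ (cWeight4 F) (dWeight4 F) F.z F.zb q.2
      (a + q.1) (b + q.1) (D.expo .tttt) (D.expo .tttt)))
    (htail : ∀ q : ℕ × ℕ, q ∉ S → InDescendantRange ℓ q.1 q.2 →
      ∀ E ∈ Icc (a + q.1) (b + q.1), 0 ≤ sector4Term F D E q.2) :
    ∀ Δ ∈ Ico a b, Pos4 F.toFunctional D Δ ℓ :=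
  pos4_on_cell_Ico F D ha S _ (fun q _ Δ hΔ => by
    rw [sector4Term_eq_twoWeightEval]
    exact cornerBound₂_le (cWeight4 F) (dWeight4 F) F.z F.zb F.hz F.hzb q.2 (E := Δ + (q.1 : ℝ))
      ⟨by linarith [hΔ.1], by linarith [hΔ.2]⟩ ⟨le_rfl, le_rfl⟩) hX htail

/-- **Charge-`4` BOUND-CELL RULE with corner tables** (cell `[a, b)`, `a ≥ ℓ + 1`, monotone tables
`hrCoeffMLo/MHi`): the head number `headCellSumM ℓ a b S Φlo ≥ 0` with the corner tables and nonnegative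
tail terms give `Pos4` at every `Δ ∈ [a, b)` — for the spinning rows of `O2Obligations.spinning_4` that
start at the bound. [cite: KosPolandSimmonsduffin2014, §3.3 eq. (3.16), §4 eqs. (4.2)–(4.3)]
[cite: DolanOsborn2004, §3 eq. (3.11)] [cite: HogervorstRychkov2013, §3 eqs. (3.6), (3.9)] -/
theorem pos4_on_boundCell_Ico_of_corners (F : ScanFunctional) (D : Dims) {ℓ : ℕ} {a b : ℝ}
    (ha : (ℓ : ℝ) + 1 ≤ a) (S : Finset (ℕ × ℕ))
    (hX : 0 ≤ headCellSumM ℓ a b S (fun q => cornerBound₂ (cWeight4 F) (dWeight4 F) F.z F.zb q.2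
      (a + q.1) (b + q.1) (D.expo .tttt) (D.expo .tttt)))
    (htail : ∀ q : ℕ × ℕ, q ∉ S → InDescendantRange ℓ q.1 q.2 →
      ∀ E ∈ Icc (a + q.1) (b + q.1), 0 ≤ sector4Term F D E q.2) :
    ∀ Δ ∈ Ico a b, Pos4 F.toFunctional D Δ ℓ := by
  have hval : ∀ Δ' ∈ Icc a b, IsRegularPoint3D Δ' ℓ → ∀ G : Label → ℝ → ℝ → ℝ,
      (∀ L ∈ labels4, IsConformalBlock3D 0 0 Δ' ℓ (G L)) → 0 ≤ sector4Value F D G := by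
    intro Δ' hΔI hreg G hG
    have hlt : unitarityBound3D ℓ < Δ' :=
      lt_of_le_of_ne (((unitarityBound3D_le_add_one ℓ).trans ha).trans hΔI.1) (Ne.symm hreg.1)
    refine sector4Value_nonneg_of_termwise F D hlt hreg.2 S ?_
      (fun q hq hr' => htail q hq hr' (Δ' + (q.1 : ℝ)) ⟨by linarith [hΔI.1], by linarith [hΔI.2]⟩) hG
    have hsum : headCellSumM ℓ a b S (fun q => cornerBound₂ (cWeight4 F) (dWeight4 F) F.z F.zb q.2
        (a + q.1) (b + q.1) (D.expo .tttt) (D.expo .tttt)) ≤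
        ∑ q ∈ S, hrCoeff Δ' ℓ q.1 q.2 * sector4Term F D (Δ' + (q.1 : ℝ)) q.2 := by
      refine Finset.sum_le_sum fun q hq => ?_
      have hA := hrCoeff_monotone_sandwich ha hΔI.1 hΔI.2 q.1 q.2
      refine min_mul_le_mul_of_bounds hA.2.1 hA.2.2 (hA.1.trans hA.2.1) ?_
      rw [sector4Term_eq_twoWeightEval]
      exact cornerBound₂_le (cWeight4 F) (dWeight4 F) F.z F.zb F.hz F.hzb q.2 (E := Δ' + (q.1 : ℝ))
        ⟨by linarith [hΔI.1], by linarith [hΔI.2]⟩ ⟨le_rfl, le_rfl⟩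
    have heq : ∑ q ∈ S, hrCoeff Δ' ℓ q.1 q.2 / legendreLam ℓ * sector4Term F D (Δ' + (q.1 : ℝ)) q.2 =
        (legendreLam ℓ)⁻¹ * ∑ q ∈ S, hrCoeff Δ' ℓ q.1 q.2 * sector4Term F D (Δ' + (q.1 : ℝ)) q.2 := by
      rw [Finset.mul_sum]
      exact Finset.sum_congr rfl fun q _ => by rw [div_eq_inv_mul]; ring
    rw [heq]
    exact mul_nonneg (inv_nonneg.mpr (legendreLam_pos ℓ).le) (hX.trans hsum)
  intro Δ hΔ
  by_cases hr : IsRegularPoint3D Δ ℓ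
  · exact pos4_of_forall_sector4Value_nonneg F D fun G hG => hval Δ ⟨hΔ.1, hΔ.2.le⟩ hr G hG
  · have hbd : unitarityBound3D ℓ ≤ Δ := ((unitarityBound3D_le_add_one ℓ).trans ha).trans hΔ.1
    refine pos4_of_eventually_right F D hr ?_
    filter_upwards [eventually_isRegularPoint3D_nhdsGT_of_bound_le hbd, Ioo_mem_nhdsGT hΔ.2]
      with Δ' hΔ'reg hΔ'
    exact ⟨hΔ'reg, fun G hG => hval Δ' ⟨hΔ.1.trans hΔ'.1.le, hΔ'.2.le⟩ hΔ'reg G hG⟩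

/-- **The scalar point of `O2Obligations.scalar_4` at the external `t`-like gap** and every other single
point follow from a cell containing it; recorded as the trivial specialisation.
[cite: ChesterEtAl2020, §3.1 (functional conditions)] -/
theorem pos4_of_cell_mem (F : ScanFunctional) (D : Dims) {ℓ : ℕ} {a b Δ : ℝ} (hΔ : Δ ∈ Ico a b)
    (h : ∀ Δ' ∈ Ico a b, Pos4 F.toFunctional D Δ' ℓ) : Pos4 F.toFunctional D Δ ℓ :=
  h Δ hΔ

/-- **Cell tails from (M)/(T), charge `4`** (as `cellTail0p_of_termwise`). [cite: HogervorstRychkov2013, §3 eqs. (3.6), (3.9)] -/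
theorem cellTail4_of_termwise (F : ScanFunctional) (D : Dims) {ℓ : ℕ} {a b E₀ ET τ : ℝ}
    (hτ : (ℓ : ℝ) + τ ≤ a) (N₀ : ℕ) (hN : E₀ ≤ a + N₀)
    (S : Finset (ℕ × ℕ)) (hS : ∀ q : ℕ × ℕ, InDescendantRange ℓ q.1 q.2 → q.1 < N₀ → q ∈ S)
    (hM : ∀ (j : ℕ) (E : ℝ), E₀ ≤ E → E < ET → (j : ℝ) + τ ≤ E → 0 ≤ sector4Term F D E j)
    (hT : ∀ E : ℝ, ET ≤ E → ∀ j : ℕ, (j : ℝ) ≤ E → 0 ≤ sector4Term F D E j)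
    (hτ0 : 0 ≤ τ) :
    ∀ q : ℕ × ℕ, q ∉ S → InDescendantRange ℓ q.1 q.2 →
      ∀ E ∈ Icc (a + q.1) (b + q.1), 0 ≤ sector4Term F D E q.2 := by
  intro q hq hr E hE
  have hn : (N₀ : ℝ) ≤ (q.1 : ℝ) := by
    have : ¬ q.1 < N₀ := fun h => hq (hS q hr h)
    exact_mod_cast not_lt.1 this
  have hE0 : E₀ ≤ E := by linarith [hE.1]
  have h1 : (q.2 : ℝ) ≤ (ℓ : ℝ) + (q.1 : ℝ) := by exact_mod_cast hr.2.1
  have hjE : (q.2 : ℝ) + τ ≤ E := by linarith [hE.1]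
  have hjE' : (q.2 : ℝ) ≤ E := by linarith
  by_cases hlt : E < ET
  · exact hM q.2 E hE0 hlt hjE
  · exact hT E (not_lt.1 hlt) q.2 hjE'

end Literature.MathematicalPhysics.QuantumFieldTheory.O2ChargeFourRules
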